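import Mathlib
import HarnessLib
import Literature.Analysis.FluidPDE.OctahedralSymmetry
import Literature.MathematicalPhysics.QuantumLattice.EuclideanAction
import Summits.QuantumFields.YangMills.Theses.PencilRigidity
import Summits.QuantumFields.YangMills.Theorems.PencilRigidityShellRigidityExponentReduction
import Summits.QuantumFields.YangMills.Theorems.PencilRigidityShellRigidityAxisLaplace
import Summits.QuantumFields.YangMills.Theorems.PencilRigidityShellRigidityPlanarDiscSections
import Summits.QuantumFields.YangMills.Theorems.PencilRigidityShellRigidityRadialLift
import Summits.QuantumFields.YangMills.Theorems.PencilRigidityShellRigidityConeOfDiscSections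
import Summits.QuantumFields.YangMills.Theorems.PencilRigidityShellRigidityThalesGlue
import Summits.QuantumFields.YangMills.Theorems.PencilRigidityShellRigidityAngleBandLimit
import Summits.QuantumFields.YangMills.Theorems.PencilRigidityShellRigidityTransversePinch

/-!
# `PencilRigidity.ShellRigidity` — closing file of line `thales-slit-exact-cone-type` (stmt-QuantumFields-11685)

`ShellRigidity_of : Summit.QuantumFields.YangMills.Theses.PencilRigidity.ShellRigidity` (the crux BY NAME, no
hypotheses), second line lead, 2026-08-16. Composition: exponent reduction (`stub_exponentReduction`, landed) gives the
window `a = 10 - min η 7 ∈ [3,10)`; the 45°-rotated kernel `K' = K ∘ R₋₄₅` turns the crux's DIAGONAL clause into the axis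
clause of `K'`; `stub_axisLaplace` (landed) gives the two finite-measure families `μ_ε` (axis frame of `K`) and `μ'_ε`
(axis frame of `K'` = diagonal frame of `K`); `stub_planarDiscSections` + `stub_coneOfDiscSections` (landed) give the exact
light cones of both; `stub_angleBandLimit` (this line) gives `K(t cos φ, t sin φ, y, z) = b₀ + b₁ cos 4φ + b₂ cos 8φ` with
the chart identity at imaginary angle, for `K` and for `K'`; `stub_transversePinch` (this line) kills `b₁, b₂`; norm
reduction (`RadialLift.norm_reduction`, landed) finishes. Bookkeeping in `…ThalesGlue` (landed). Hypothesis use: H1 in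
axisLaplace/planarDiscSections/pinch; H2 in exponentReduction, the type bound (`a < 12`) and the pinch (`a - 2 < 8`); H3
throughout the glue; H4 for `μ`, H5 for `μ'` (load-bearing twice: the cone of `μ` and the mode-4 pinch). Line narrative,
barriers and the disproof ledger: `Cruxes/ShellRigidity/Lines/thales-slit-exact-cone-type.md`.
-/

noncomputable section

namespace Summit.QuantumFields.YangMills.Cruxes.ShellRigidity.ThalesSlitExactConeType

open MeasureTheory Complex Real
open scoped InnerProductSpace BigOperators
open Literature.MathematicalPhysics.QuantumLattice
open Literature.Analysis.FluidPDE (signedPermIsometry signedPermIsometry_apply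
  isSignedPermIsometry_signedPermIsometry)
open Summit.QuantumFields.YangMills.Theses.PencilRigidity
open Summit.QuantumFields.YangMills.Cruxes.ShellRigidity.TransverseSmearingPlanarThreshold
  (stub_exponentReduction stub_axisLaplace stub_planarDiscSections stub_coneOfDiscSections
  RadialLift.norm_reduction)

local notation "E4" => EuclideanSpace ℝ (Fin 4)

/-! The two stubs of this line, `stub_angleBandLimit` and `stub_transversePinch`, are imported from their landed files. -/

/-! ## Glue IV — the composition: the four stubs prove the crux BY NAME -/

/-- **The crux `PencilRigidity.ShellRigidity` from the four registered stubs** (and the landed front end of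
line `transverse-smearing-planar-threshold`). -/
theorem ShellRigidity_of : ShellRigidity := by
  intro K hcont hbd hW h4 h5
  ------------------------------------------------------------------
  -- Reduction: planar rotation invariance at every transverse offset suffices (norm reduction).
  ------------------------------------------------------------------
  suffices hplanar : ∀ t : ℝ, 0 < t → ∀ y z φ : ℝ,
      K (WithLp.toLp 2 ![t * Real.cos φ, t * Real.sin φ, y, z]) = K (WithLp.toLp 2 ![t, 0, y, z]) by
    have hswap12 : ∀ a b c d : ℝ,
        K (WithLp.toLp 2 ![a, c, b, d]) = K (WithLp.toLp 2 ![a, b, c, d]) := by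
      intro a b c d
      refine K_of_coords hW (Equiv.swap 1 2) (![(1 : ℤˣ), 1, 1, 1]) _ _ fun j => ?_
      fin_cases j <;> simp [Equiv.swap_apply_def]
    have hswap13 : ∀ a b c d : ℝ,
        K (WithLp.toLp 2 ![a, d, c, b]) = K (WithLp.toLp 2 ![a, b, c, d]) := by
      intro a b c d
      refine K_of_coords hW (Equiv.swap 1 3) (![(1 : ℤˣ), 1, 1, 1]) _ _ fun j => ?_
      fin_cases j <;> simp [Equiv.swap_apply_def]
    have planar : ∀ x y : ℝ × ℝ, x ≠ 0 → x.1 ^ 2 + x.2 ^ 2 = y.1 ^ 2 + y.2 ^ 2 → ∀ z : ℝ × ℝ,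
        K (WithLp.toLp 2 ![y.1, y.2, z.1, z.2]) = K (WithLp.toLp 2 ![x.1, x.2, z.1, z.2]) := by
      intro x y hx hxy z
      set r : ℝ := Real.sqrt (x.1 ^ 2 + x.2 ^ 2) with hr_def
      have hpos : 0 < x.1 ^ 2 + x.2 ^ 2 := by
        rcases x with ⟨x1, x2⟩
        by_contra hle
        have h1 : x1 = 0 := by nlinarith [sq_nonneg x1, sq_nonneg x2]
        have h2 : x2 = 0 := by nlinarith [sq_nonneg x1, sq_nonneg x2]
        exact hx (by simp [h1, h2])
      have hr : 0 < r := Real.sqrt_pos.2 hpos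
      have hr2 : r ^ 2 = x.1 ^ 2 + x.2 ^ 2 := Real.sq_sqrt hpos.le
      have key : ∀ p q : ℝ, p ^ 2 + q ^ 2 = x.1 ^ 2 + x.2 ^ 2 →
          K (WithLp.toLp 2 ![p, q, z.1, z.2]) = K (WithLp.toLp 2 ![r, 0, z.1, z.2]) := by
        intro p q hpq
        obtain ⟨φ, hp, hq⟩ := exists_polar hr (hpq.trans hr2.symm)
        rw [hp, hq]
        exact hplanar r hr z.1 z.2 φ
      rw [key y.1 y.2 hxy.symm, key x.1 x.2 rfl]
    intro R x _hx
    rw [RadialLift.norm_reduction K hswap12 hswap13 planar (R x),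
      RadialLift.norm_reduction K hswap12 hswap13 planar x, LinearIsometryEquiv.norm_map]
  ------------------------------------------------------------------
  -- (0) exponent reduction: the decay window `a = 10 - min η 7 ∈ [3, 10)`
  ------------------------------------------------------------------
  obtain ⟨C₀, η, hη, hb₀⟩ := hbd
  obtain ⟨C, hC⟩ := stub_exponentReduction K η hη hcont ⟨C₀, hb₀⟩ hW h4
  set a : ℝ := 10 - min η 7 with ha_def
  have ha3 : 3 ≤ a := by have := min_le_right η 7; linarith
  have ha10 : a < 10 := by have : 0 < min η 7 := lt_min hη (by norm_num); linarith
  have hdecay : ∀ x : E4, x ≠ 0 → |K x| ≤ C * (1 + ‖x‖ ^ (-a)) := by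
    intro x hx
    have := hC x hx
    rwa [show min η 7 - 10 = -a by rw [ha_def]; ring] at this
  ------------------------------------------------------------------
  -- (1) symmetries of `K` from `W(B₄)`
  ------------------------------------------------------------------
  have hθK := hθ_of_hW hW
  have hPK := hP_of_hW hW
  have hrotK := hrot_of_hW hW
  have hflip1K := hflip1_of_hW hW
  have hswapK := hswap01_of_hW hW
  have hnegswapPK := hnegswapP_of_hW hW
  have hnegswapK := hnegswap_of_hW hW
  ------------------------------------------------------------------
  -- (2) the rotated kernel `K' = K ∘ R₋₄₅` and its axis-frame hypotheses
  ------------------------------------------------------------------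
  set K' : E4 → ℝ := fun x =>
    K (WithLp.toLp 2 ![(x 0 + x 1) / Real.sqrt 2, (x 1 - x 0) / Real.sqrt 2, x 2, x 3]) with hK'_def
  have hs2 : 0 < Real.sqrt 2 := Real.sqrt_pos.2 two_pos
  have hs2' : Real.sqrt 2 ≠ 0 := hs2.ne'
  have hss : Real.sqrt 2 * Real.sqrt 2 = 2 := Real.mul_self_sqrt two_pos.le
  have hsq : Real.sqrt 2 ^ 2 = 2 := Real.sq_sqrt two_pos.le
  have hinv : (Real.sqrt 2)⁻¹ * (Real.sqrt 2)⁻¹ = 1 / 2 := by rw [← mul_inv, hss]; norm_num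
  have rot_ne : ∀ x : E4, x ≠ 0 →
      (WithLp.toLp 2 ![(x 0 + x 1) / Real.sqrt 2, (x 1 - x 0) / Real.sqrt 2, x 2, x 3] : E4) ≠ 0 := by
    intro x hx h0
    apply hx
    have := norm_rot45 x
    rw [h0, norm_zero] at this
    exact norm_eq_zero.1 this.symm
  have hcont' : ContinuousOn K' {x : E4 | x ≠ 0} :=
    hcont.comp continuous_rot45.continuousOn fun x hx => rot_ne x hx
  have hdecay' : ∀ x : E4, x ≠ 0 → |K' x| ≤ C * (1 + ‖x‖ ^ (-a)) := by
    intro x hx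
    have := hdecay _ (rot_ne x hx)
    rwa [norm_rot45] at this
  -- symmetries of `K'`
  have hθ' : ∀ x y : E4, y 0 = -x 0 → y 1 = x 1 → y 2 = x 2 → y 3 = x 3 → K' y = K' x := by
    intro x y h0 h1 h2 h3
    simp only [hK'_def]
    rw [← hswapK (WithLp.toLp 2 ![(x 0 + x 1) / Real.sqrt 2, (x 1 - x 0) / Real.sqrt 2, x 2, x 3])]
    congr 1; ext i; fin_cases i
    · simp [h0, h1, h2, h3]; ring
    · simp [h0, h1, h2, h3]; ring
    · simp [h0, h1, h2, h3]
    · simp [h0, h1, h2, h3]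
  have hP' : ∀ x y : E4, y 0 = x 0 → y 1 = -x 1 → y 2 = -x 2 → y 3 = -x 3 → K' y = K' x := by
    intro x y h0 h1 h2 h3
    simp only [hK'_def]
    rw [← hnegswapPK (WithLp.toLp 2 ![(x 0 + x 1) / Real.sqrt 2, (x 1 - x 0) / Real.sqrt 2, x 2, x 3])]
    congr 1; ext i; fin_cases i
    · simp [h0, h1, h2, h3]; ring
    · simp [h0, h1, h2, h3]; ring
    · simp [h0, h1, h2, h3]
    · simp [h0, h1, h2, h3]
  have hrot' : ∀ x : E4, K' (WithLp.toLp 2 ![-x 1, x 0, x 2, x 3]) = K' x := by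
    intro x
    simp only [hK'_def]
    rw [← hrotK (WithLp.toLp 2 ![(x 0 + x 1) / Real.sqrt 2, (x 1 - x 0) / Real.sqrt 2, x 2, x 3])]
    congr 1; ext i; fin_cases i
    · simp; ring
    · simp
    · simp
    · simp
  have hflip1' : ∀ x : E4, K' (WithLp.toLp 2 ![x 0, -x 1, x 2, x 3]) = K' x := by
    intro x
    simp only [hK'_def]
    rw [← hnegswapK (WithLp.toLp 2 ![(x 0 + x 1) / Real.sqrt 2, (x 1 - x 0) / Real.sqrt 2, x 2, x 3])]
    congr 1; ext i; fin_cases i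
    · simp; ring
    · simp; ring
    · simp
    · simp
  -- the crux's DIAGONAL clause is the axis clause of `K'`
  have h4' : ∀ (m : ℕ) (x : Fin m → E4) (c : Fin m → ℝ), (∀ i, 0 < x i 0) →
      0 ≤ ∑ i, ∑ j, c i * c j * K' (timeReflection 4 (x i) - x j) := by
    intro m x c hx
    have key : ∀ i j, K' (timeReflection 4 (x i) - x j) =
        K (LinearIsometryEquiv.piLpCongrLeft 2 ℝ ℝ (Equiv.swap (0 : Fin 4) 1)
            (WithLp.toLp 2 ![(x i 0 + x i 1) / Real.sqrt 2, (x i 1 - x i 0) / Real.sqrt 2, x i 2, x i 3]) -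
          WithLp.toLp 2 ![(x j 0 + x j 1) / Real.sqrt 2, (x j 1 - x j 0) / Real.sqrt 2, x j 2, x j 3]) := by
      intro i j
      simp only [hK'_def]
      congr 1; ext k
      fin_cases k
      · simp [swap01_apply, timeReflection_apply]; ring
      · simp [swap01_apply, timeReflection_apply]; ring
      · simp [swap01_apply, timeReflection_apply, Equiv.swap_apply_def]
      · simp [swap01_apply, timeReflection_apply, Equiv.swap_apply_def]
    simp_rw [key]
    refine h5 m (fun i => WithLp.toLp 2
      ![(x i 0 + x i 1) / Real.sqrt 2, (x i 1 - x i 0) / Real.sqrt 2, x i 2, x i 3]) c fun i => ?_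
    show (x i 1 - x i 0) / Real.sqrt 2 < (x i 0 + x i 1) / Real.sqrt 2
    rw [div_lt_div_iff_of_pos_right hs2]
    linarith [hx i]
  ------------------------------------------------------------------
  -- (3) boundedness off slabs, then the two axis Laplace families `μ`, `μ'`
  ------------------------------------------------------------------
  have slab : ∀ (L : E4 → ℝ), (∀ x : E4, x ≠ 0 → |L x| ≤ C * (1 + ‖x‖ ^ (-a))) →
      ∀ ε : ℝ, 0 < ε → ∃ B : ℝ, ∀ x : E4, ε ≤ |x 0| → |L x| ≤ B := by
    intro L hL ε hε
    have hC0 : 0 ≤ C := by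
      have h := hdecay (EuclideanSpace.single 0 1) (by simp)
      have h1 : ‖(EuclideanSpace.single (0 : Fin 4) (1 : ℝ) : E4)‖ = 1 := by simp
      rw [h1, Real.one_rpow] at h
      linarith [abs_nonneg (K (EuclideanSpace.single 0 1))]
    refine ⟨C * (1 + ε ^ (-a)), fun x hx => ?_⟩
    have hεx : ε ≤ ‖x‖ := hx.trans (by simpa using PiLp.norm_apply_le x 0)
    have hx0 : x ≠ 0 := by
      intro h0; rw [h0, norm_zero] at hεx; linarith
    calc |L x| ≤ C * (1 + ‖x‖ ^ (-a)) := hL x hx0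
      _ ≤ C * (1 + ε ^ (-a)) := by
        have h1 : ‖x‖ ^ (-a) ≤ ε ^ (-a) := Real.rpow_le_rpow_of_nonpos hε hεx (by linarith)
        have h2 : 1 + ‖x‖ ^ (-a) ≤ 1 + ε ^ (-a) := by linarith
        exact mul_le_mul_of_nonneg_left h2 hC0
  have hbddK := slab K hdecay
  have hbddK' := slab K' hdecay'
  -- the axis family of `K`
  have hLK := stub_axisLaplace K hcont hbddK hθK hPK h4
  have hLK' := stub_axisLaplace K' hcont' hbddK' hθ' hP' h4'
  classical
  -- turn `∀ ε > 0, ∃ μ` into functions `ℝ → Measure E4`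
  choose μd hμd using hLK
  choose μd' hμd' using hLK'
  let μ : ℝ → Measure E4 := fun ε => if h : 0 < ε then μd ε h else 0
  let μ' : ℝ → Measure E4 := fun ε => if h : 0 < ε then μd' ε h else 0
  have hμ : ∀ (ε : ℝ) (h : 0 < ε), μ ε = μd ε h := fun ε h => dif_pos h
  have hμ' : ∀ (ε : ℝ) (h : 0 < ε), μ' ε = μd' ε h := fun ε h => dif_pos h
  have hfin : ∀ ε : ℝ, 0 < ε → IsFiniteMeasure (μ ε) := fun ε h => by rw [hμ ε h]; exact (hμd ε h).1
  have hfin' : ∀ ε : ℝ, 0 < ε → IsFiniteMeasure (μ' ε) := fun ε h => by rw [hμ' ε h]; exact (hμd' ε h).1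
  have hE : ∀ ε : ℝ, 0 < ε → μ ε {p : E4 | p 0 < 0} = 0 := fun ε h => by rw [hμ ε h]; exact (hμd ε h).2.1
  have hE' : ∀ ε : ℝ, 0 < ε → μ' ε {p : E4 | p 0 < 0} = 0 := fun ε h => by
    rw [hμ' ε h]; exact (hμd' ε h).2.1
  have hrep : ∀ ε : ℝ, 0 < ε → ∀ t : ℝ, 0 ≤ t → ∀ v : E4, v 0 = 0 →
      ((K (EuclideanSpace.single 0 (ε + t) + v) : ℝ) : ℂ) =
        ∫ p, Complex.exp ((((-(t * p 0) : ℝ)) : ℂ) + ((⟪v, p⟫_ℝ : ℝ) : ℂ) * Complex.I) ∂(μ ε) :=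
    fun ε h t ht v hv => by rw [hμ ε h]; exact (hμd ε h).2.2 t ht v hv
  have hrep' : ∀ ε : ℝ, 0 < ε → ∀ t : ℝ, 0 ≤ t → ∀ v : E4, v 0 = 0 →
      ((K' (EuclideanSpace.single 0 (ε + t) + v) : ℝ) : ℂ) =
        ∫ p, Complex.exp ((((-(t * p 0) : ℝ)) : ℂ) + ((⟪v, p⟫_ℝ : ℝ) : ℂ) * Complex.I) ∂(μ' ε) :=
    fun ε h t ht v hv => by rw [hμ' ε h]; exact (hμd' ε h).2.2 t ht v hv
  -- planar points in the two frames
  have ptK : ∀ s b : ℝ, (EuclideanSpace.single 0 s + EuclideanSpace.single 1 b : E4) =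
      WithLp.toLp 2 ![s, b, 0, 0] := by
    intro s b; ext i; fin_cases i <;> simp
  have repK : ∀ ε : ℝ, 0 < ε → ∀ t : ℝ, 0 ≤ t → ∀ b : ℝ,
      ((K (WithLp.toLp 2 ![ε + t, b, 0, 0]) : ℝ) : ℂ) =
        ∫ p, Complex.exp ((((-(t * p 0) : ℝ)) : ℂ) + ((b * p 1 : ℝ) : ℂ) * Complex.I) ∂(μ ε) := by
    intro ε hε t ht b
    rw [← ptK, hrep ε hε t ht (EuclideanSpace.single 1 b) (by simp)]
    simp_rw [inner_single_one]
  have repK' : ∀ ε : ℝ, 0 < ε → ∀ t : ℝ, 0 ≤ t → ∀ b : ℝ,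
      ((K' (WithLp.toLp 2 ![ε + t, b, 0, 0]) : ℝ) : ℂ) =
        ∫ p, Complex.exp ((((-(t * p 0) : ℝ)) : ℂ) + ((b * p 1 : ℝ) : ℂ) * Complex.I) ∂(μ' ε) := by
    intro ε hε t ht b
    rw [← ptK, hrep' ε hε t ht (EuclideanSpace.single 1 b) (by simp)]
    simp_rw [inner_single_one]
  ------------------------------------------------------------------
  -- (4) Thales disc sections of the planar traces, and the exact light cones
  ------------------------------------------------------------------
  -- the planar trace of `K` and of `K'`
  set F : ℝ × ℝ → ℝ := fun q => K (WithLp.toLp 2 ![q.1, q.2, 0, 0]) with hF_def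
  set F' : ℝ × ℝ → ℝ := fun q => K' (WithLp.toLp 2 ![q.1, q.2, 0, 0]) with hF'_def
  have planar_ne : ∀ q : ℝ × ℝ, q ≠ 0 → (WithLp.toLp 2 ![q.1, q.2, 0, 0] : E4) ≠ 0 := by
    intro q hq h0
    apply hq
    have h1 := congrArg (fun v : E4 => v 0) h0
    have h2 := congrArg (fun v : E4 => v 1) h0
    simp at h1 h2
    exact Prod.ext h1 h2
  have contF : ∀ (L : E4 → ℝ), ContinuousOn L {x : E4 | x ≠ 0} →
      ContinuousOn (fun q : ℝ × ℝ => L (WithLp.toLp 2 ![q.1, q.2, 0, 0])) {q | q ≠ 0} := by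
    intro L hL
    have hφ : Continuous fun q : ℝ × ℝ => (WithLp.toLp 2 ![q.1, q.2, 0, 0] : E4) := by
      refine (PiLp.continuous_toLp 2 _).comp (continuous_pi fun i => ?_)
      fin_cases i <;> simp <;> fun_prop
    exact hL.comp hφ.continuousOn fun q hq => planar_ne q hq
  have symF : ∀ t s : ℝ, F (t, s) = F (s, t) ∧ F (t, s) = F (t, -s) ∧ F (t, s) = F (-t, s) := by
    intro t s
    refine ⟨?_, ?_, ?_⟩
    · simp only [hF_def]; rw [← hswapK]; rfl
    · simp only [hF_def]; rw [← hflip1K]; simp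
    · simp only [hF_def]
      rw [← hθK (WithLp.toLp 2 ![-t, s, 0, 0]) (WithLp.toLp 2 ![t, s, 0, 0]) (by simp) rfl rfl rfl]
  have symF' : ∀ t s : ℝ, F' (t, s) = F' (s, t) ∧ F' (t, s) = F' (t, -s) ∧ F' (t, s) = F' (-t, s) := by
    intro t s
    have hswapK' : ∀ x : E4, K' (WithLp.toLp 2 ![x 1, x 0, x 2, x 3]) = K' x := by
      intro x
      simp only [hK'_def]
      rw [← hflip1K (WithLp.toLp 2 ![(x 0 + x 1) / Real.sqrt 2, (x 1 - x 0) / Real.sqrt 2, x 2, x 3])]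
      congr 1; ext i; fin_cases i
      · simp; ring
      · simp; ring
      · simp
      · simp
    refine ⟨?_, ?_, ?_⟩
    · simp only [hF'_def]; rw [← hswapK']; rfl
    · simp only [hF'_def]; rw [← hflip1']; simp
    · simp only [hF'_def]
      rw [← hθ' (WithLp.toLp 2 ![-t, s, 0, 0]) (WithLp.toLp 2 ![t, s, 0, 0]) (by simp) rfl rfl rfl]
  -- the diagonal-frame representation of `F` is the axis family of `K'`, and vice versa
  have diagF : ∀ ε : ℝ, 0 < ε → ∃ ν : Measure E4, IsFiniteMeasure ν ∧ ν {p | p 0 < 0} = 0 ∧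
      ∀ u : ℝ, 0 ≤ u → ∀ v : ℝ,
        ((F ((ε + u + v) / Real.sqrt 2, (ε + u - v) / Real.sqrt 2) : ℝ) : ℂ) =
          ∫ p, cexp ((((-(u * p 0) : ℝ)) : ℂ) + ((v * p 1 : ℝ) : ℂ) * I) ∂ν := by
    intro ε hε
    refine ⟨μ' ε, hfin' ε hε, hE' ε hε, fun u hu v => ?_⟩
    rw [← repK' ε hε u hu v]
    simp only [hF_def, hK'_def]
    rw [← hflip1K (WithLp.toLp 2 ![(ε + u + v) / Real.sqrt 2, (ε + u - v) / Real.sqrt 2, 0, 0])]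
    congr 2; ext i; fin_cases i
    · simp
    · simp; ring
    · simp
    · simp
  have diagF' : ∀ ε : ℝ, 0 < ε → ∃ ν : Measure E4, IsFiniteMeasure ν ∧ ν {p | p 0 < 0} = 0 ∧
      ∀ u : ℝ, 0 ≤ u → ∀ v : ℝ,
        ((F' ((ε + u + v) / Real.sqrt 2, (ε + u - v) / Real.sqrt 2) : ℝ) : ℂ) =
          ∫ p, cexp ((((-(u * p 0) : ℝ)) : ℂ) + ((v * p 1 : ℝ) : ℂ) * I) ∂ν := by
    intro ε hε
    refine ⟨μ ε, hfin ε hε, hE ε hε, fun u hu v => ?_⟩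
    rw [← repK ε hε u hu v]
    simp only [hF'_def, hK'_def]
    rw [← hflip1K (WithLp.toLp 2 ![ε + u, v, 0, 0])]
    congr 2; ext i; fin_cases i
    · simp
      linear_combination (2 * (ε + u)) * hinv
    · simp
      linear_combination (-2 * v) * hinv
    · simp
    · simp
  -- the cones
  have coneK : ∀ ε : ℝ, 0 < ε → μ ε {p : E4 | p 0 < |p 1|} = 0 := by
    intro ε hε
    haveI := hfin ε hε
    obtain ⟨M, hM⟩ := stub_planarDiscSections F (contF K hcont) symF diagF ε hε
    refine stub_coneOfDiscSections (μ ε) (hE ε hε) M fun t ht => ?_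
    obtain ⟨f, hf, hfM, hfb⟩ := hM t ht
    refine ⟨f, hf, hfM, fun b hb => ?_⟩
    rw [hfb b hb]
    exact repK ε hε t ht.le b
  have coneK' : ∀ ε : ℝ, 0 < ε → μ' ε {p : E4 | p 0 < |p 1|} = 0 := by
    intro ε hε
    haveI := hfin' ε hε
    obtain ⟨M, hM⟩ := stub_planarDiscSections F' (contF K' hcont') symF' diagF' ε hε
    refine stub_coneOfDiscSections (μ' ε) (hE' ε hε) M fun t ht => ?_
    obtain ⟨f, hf, hfM, hfb⟩ := hM t ht
    refine ⟨f, hf, hfM, fun b hb => ?_⟩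
    rw [hfb b hb]
    exact repK' ε hε t ht.le b
  ------------------------------------------------------------------
  -- (5) the angle band limit for `K` and `K'`
  ------------------------------------------------------------------
  have ha0 : 0 < a := by linarith
  have ha12 : a < 12 := by linarith
  obtain ⟨b, hb⟩ := stub_angleBandLimit K C a ha0 ha12 hdecay hrotK hflip1K μ hfin hE coneK hrep
  obtain ⟨b', hb'⟩ := stub_angleBandLimit K' C a ha0 ha12 hdecay' hrot' hflip1' μ' hfin' hE' coneK' hrep'
  -- the diagonal trace of `K` is the axis trace of `K'`
  have hb'' : ∀ t : ℝ, 0 < t → ∀ y z : ℝ,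
      (∀ φ : ℝ, K (WithLp.toLp 2 ![t * Real.cos (φ - π / 4), t * Real.sin (φ - π / 4), y, z]) =
        b' 0 t y z + b' 1 t y z * Real.cos (4 * φ) + b' 2 t y z * Real.cos (8 * φ)) ∧
      (∀ χ ε : ℝ, 0 < ε → ε < t * Real.exp (-|χ|) →
        (((b' 0 t y z + b' 1 t y z * Real.cosh (4 * χ) + b' 2 t y z * Real.cosh (8 * χ) : ℝ)) : ℂ) =
          ∫ p, Complex.exp ((((-((t * Real.cosh χ - ε) * p 0 + t * Real.sinh χ * p 1)) : ℝ) : ℂ) +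
            ((y * p 2 + z * p 3 : ℝ) : ℂ) * Complex.I) ∂(μ' ε)) := by
    intro t ht y z
    refine ⟨fun φ => ?_, (hb' t ht y z).2⟩
    rw [← (hb' t ht y z).1 φ]
    simp only [hK'_def]
    have hc : Real.cos (φ - π / 4) = (Real.cos φ + Real.sin φ) / Real.sqrt 2 := by
      rw [Real.cos_sub, Real.cos_pi_div_four, Real.sin_pi_div_four]
      field_simp
      rw [hsq]
    have hs : Real.sin (φ - π / 4) = (Real.sin φ - Real.cos φ) / Real.sqrt 2 := by
      rw [Real.sin_sub, Real.cos_pi_div_four, Real.sin_pi_div_four]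
      field_simp
      rw [hsq]
    congr 2; ext i; fin_cases i
    · simp [hc, hs]; ring
    · simp [hc, hs]; ring
    · simp [hc, hs]
    · simp [hc, hs]
  ------------------------------------------------------------------
  -- (6) the transverse pinch
  ------------------------------------------------------------------
  exact stub_transversePinch K C a (by linarith) ha10 hcont hdecay μ μ' hfin hfin' coneK coneK' b b' hb hb''

end Summit.QuantumFields.YangMills.Cruxes.ShellRigidity.ThalesSlitExactConeType
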